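import Mathlib
import Literature.NumberTheory.Sieve.PolynomialCongruencesRootCount
import Literature.NumberTheory.LFunctions.PolynomialRootMertensFirst
import Summits.Parity.BatemanHorn.Theorems.SoloBlindSmoothPart
import Summits.Parity.BatemanHorn.Theorems.SoloBlindChebyshev
import Summits.Parity.BatemanHorn.Theorems.SoloBlindNagellLocal
import Summits.Parity.BatemanHorn.Theorems.SoloBlindNagellSmooth

/-!
# Chebyshev–Markov–Nagell for every irreducible polynomial: a fraction `1 − 1/d − o(1)` of the
# values `f(k)`, `k ≤ x`, have a prime factor `> x` — PROVED (the edge supply of Theorem 10.1′)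

Solo seat `solo-Parity-blind` (summit `Parity`, conjunct `BatemanHorn`), session 9.  Part III of
three (`SoloBlindNagellLocal`: objects and local counts; `SoloBlindNagellSmooth`: the smooth part).

`SoloBlindAlignmentGeneral.lean` (landed) decides the Ford–Maynard Type II hypothesis with free
coefficients for the value set of an arbitrary irreducible `f ∈ ℤ[X]` of degree `d ≥ 2`, GIVEN a
supply of "edges" `(k, p)`, `k ≤ x`, `p > x` prime, `p ∣ f(k)`: some sign pattern keeps a fraction
`1/D`, `D ≤ d`, of the trivial bound `E = #edges`.  For `f = X² + 1` the supply
`E ≥ (1/2 − o(1)) x` is `SoloBlindChebyshev.lean`.  This file proves the supply for EVERY irreducible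
`f` of degree `d ≥ 2`, with no hypothesis left open:

* `bigCount_mul_log_ge` : there is `C` with
  `((d − 1) x log x − C x) ≤ bigCount f x · (d log x + C)` for all `x ≥ 2`, where
  `bigCount f x = #{1 ≤ k ≤ x : |f(k)| has a prime factor p > x}`;
* `eventually_bigCount_ge` : for every `ε > 0`, eventually `(1 − 1/d − ε) x ≤ bigCount f x`.

This is the valuation count of Chebyshev (for `t² + 1`; A. A. Markov, *Über die Primteiler der
Zahlen von der Form 1 + 4x²*, Bull. Acad. Sci. St. Petersburg 3 (1895), 55–59) in the generality of
T. Nagell, *Généralisation d'un théorème de Tchebycheff*, J. Math. Pures Appl. (8) 4 (1921),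
343–356 (citations as given in the held arXiv:1910.02832, pp. 3, 14): from below
`∑_{k ≤ x} log |f(k)| ≥ d x log x − O(x)` (`|f(k)| ≫ k^d`, Stirling), while the primes `p ≤ x`
contribute `x ∑_{p ≤ x} ρ_f(p) log p / p + O(x) = x log x + O(x)` — Mertens' first theorem for
the roots of `f` (`Literature…DegreeOnePrimes.abs_sum_primesLE_rootCount_mul_log_div_sub_log_le`,
Landau's prime ideal theorem through Dedekind–Kummer, proved in the tree), the uniform bound
`ρ_f(p^a) ≤ d M_f` for the prime powers (Nagell, *Introduction to Number Theory*, Thms 52–54; in the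
tree `Literature…exists_polyRootCountMod_prime_pow_le`, proved), and Chebyshev's
`θ(x) ≤ x log 4`, `π(x) ≪ x / log x` (Mathlib); a value `|f(k)| ≤ H x^d` carries at most
`log (H x^d)` of logarithm on primes `> x`.  Hence
`(d − 1) x log x − O(x) ≤ bigCount · (d log x + O(1))`.

Consequence (paper §10.1, Theorem 10.1′ with its hypothesis discharged): for every irreducible `f`
of degree `d ≥ 2` the free-coefficient Type II form attached to `{f(k) : k ≤ x}` with the long
variable containing the primes of `(x, H x^d]` keeps, for some sign pattern, at least the fraction
`(1 − 1/d − o(1))/d` of the number of `k ≤ x` — no log-power saving, in any range.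
No `sorry`, standard axioms only.
-/

open Finset Real Polynomial

namespace Summit.Parity.BatemanHorn.Theorems.SoloBlindNagell

open Literature.NumberTheory.Sieve
open Summit.Parity.BatemanHorn.Theorems.SoloBlindSmoothPart
open Summit.Parity.BatemanHorn.Theorems.SoloBlindNagellLocal
open Summit.Parity.BatemanHorn.Theorems.SoloBlindNagellSmooth

/-! ### The lower side: `∑_{k ≤ x} log |f(k)| ≥ d (x log x − x) − L x` -/

/-- `log |f(k)| ≥ d log k − L` for all `k ≥ 1`. -/
theorem exists_log_absVal_ge {f : ℤ[X]} (hirr : Irreducible f) (hdeg : 2 ≤ f.natDegree) :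
    ∃ L : ℝ, ∀ k : ℕ, 1 ≤ k → (f.natDegree : ℝ) * Real.log k - L ≤ Real.log (absVal f k) := by
  obtain ⟨c, hc, K, hK⟩ := exists_mul_pow_le_absVal hirr.ne_zero
  refine ⟨|Real.log c| + f.natDegree * Real.log (K + 1), fun k hk => ?_⟩
  have hd0 : (0 : ℝ) ≤ f.natDegree := by positivity
  have hK1 : (1 : ℝ) ≤ (K : ℝ) + 1 := by
    have : (0 : ℝ) ≤ K := by positivity
    linarith
  have hlogK : 0 ≤ Real.log ((K : ℝ) + 1) := Real.log_nonneg hK1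
  have habs1 : 1 ≤ absVal f k := Nat.one_le_iff_ne_zero.mpr (absVal_ne_zero hirr hdeg k)
  have hlog0 : 0 ≤ Real.log (absVal f k) := Real.log_nonneg (by exact_mod_cast habs1)
  have hk0 : (0 : ℝ) < k := by exact_mod_cast hk
  have habsc : 0 ≤ |Real.log c| := abs_nonneg _
  rcases lt_or_ge k K with hkK | hkK
  · have h1 : Real.log k ≤ Real.log ((K : ℝ) + 1) :=
      Real.log_le_log hk0 (by exact_mod_cast (by omega : k ≤ K + 1))
    have h2 := mul_le_mul_of_nonneg_left h1 hd0
    linarith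
  · have h := hK k hkK
    have h1 : Real.log (c * (k : ℝ) ^ f.natDegree) ≤ Real.log (absVal f k) :=
      Real.log_le_log (by positivity) h
    rw [Real.log_mul hc.ne' (by positivity), Real.log_pow] at h1
    have h2 : -|Real.log c| ≤ Real.log c := neg_abs_le _
    have h3 := mul_nonneg hd0 hlogK
    linarith

/-- `d (x log x − x) − L x ≤ ∑_{1 ≤ k ≤ x} log |f(k)|` (Stirling). -/
theorem sum_log_absVal_ge {f : ℤ[X]} (hirr : Irreducible f) (hdeg : 2 ≤ f.natDegree) :
    ∃ L : ℝ, ∀ x : ℕ, 1 ≤ x →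
      (f.natDegree : ℝ) * ((x : ℝ) * Real.log x - x) - L * x
        ≤ ∑ k ∈ Icc 1 x, Real.log (absVal f k) := by
  obtain ⟨L, hL⟩ := exists_log_absVal_ge hirr hdeg
  refine ⟨L, fun x hx => ?_⟩
  have h1 : ∑ k ∈ Icc 1 x, ((f.natDegree : ℝ) * Real.log k - L)
      ≤ ∑ k ∈ Icc 1 x, Real.log (absVal f k) :=
    Finset.sum_le_sum fun k hk => hL k (Finset.mem_Icc.mp hk).1
  have h2 : ∑ k ∈ Icc 1 x, ((f.natDegree : ℝ) * Real.log k - L)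
      = f.natDegree * Real.log (x.factorial) - L * x := by
    rw [Finset.sum_sub_distrib, ← Finset.mul_sum, SoloBlindChebyshev.sum_Icc_log_eq_log_factorial,
      Finset.sum_const, Nat.card_Icc, Nat.add_sub_cancel, nsmul_eq_mul]
    ring
  have h3 := Stirling.le_log_factorial_stirling (n := x) (by omega)
  have h4 : 0 ≤ Real.log x := Real.log_nonneg (by exact_mod_cast hx)
  have h5 : 0 ≤ Real.log (2 * Real.pi) := Real.log_nonneg (by linarith [Real.pi_gt_three])
  have h6 : (x : ℝ) * Real.log x - x ≤ Real.log (x.factorial) := by linarith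
  have hd0 : (0 : ℝ) ≤ f.natDegree := by positivity
  have h7 := mul_le_mul_of_nonneg_left h6 hd0
  linarith

/-! ### The upper side, per `k`: `log |f(k)| ≤ 1_{big}(k) log (H x^d) + ∑_{p ≤ x} v_p log p` -/

/-- The primes `≤ x`: the sum may be taken over all primes `≤ x`. -/
theorem sum_filter_not_lt_eq (f : ℤ[X]) (x k : ℕ) (hk : absVal f k ≠ 0) :
    ∑ p ∈ (absVal f k).primeFactors.filter (fun p : ℕ => ¬ x < p),
        (((absVal f k).factorization p : ℕ) : ℝ) * Real.log ((p : ℕ) : ℝ)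
      = ∑ p ∈ Nat.primesLE x, (((absVal f k).factorization p : ℕ) : ℝ) * Real.log ((p : ℕ) : ℝ) := by
  apply Finset.sum_subset
  · intro p hp
    rw [Finset.mem_filter, Nat.mem_primeFactors] at hp
    rw [Nat.mem_primesLE]
    exact ⟨by omega, hp.1.1⟩
  · intro p hp hnot
    rw [Nat.mem_primesLE] at hp
    have hndvd : ¬ p ∣ absVal f k := by
      intro hd
      apply hnot
      rw [Finset.mem_filter, Nat.mem_primeFactors]
      exact ⟨⟨hp.2, hd, hk⟩, by omega⟩
    simp [Nat.factorization_eq_zero_of_not_dvd hndvd]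

/-- Per-`k` decomposition of `log |f(k)|`, `1 ≤ k ≤ x`. -/
theorem log_absVal_le {f : ℤ[X]} (hirr : Irreducible f) (hdeg : 2 ≤ f.natDegree) {x k : ℕ}
    (hk1 : 1 ≤ k) (hkx : k ≤ x) :
    Real.log (absVal f k) ≤
      (if ∃ p ∈ (absVal f k).primeFactors, x < p
        then Real.log ((height f * x ^ f.natDegree : ℕ) : ℝ) else 0)
      + ∑ p ∈ Nat.primesLE x, ((absVal f k).factorization p : ℝ) * Real.log p := by
  have hn := absVal_ne_zero hirr hdeg k
  have hsplit := (Finset.sum_filter_add_sum_filter_not (absVal f k).primeFactors (fun p : ℕ => x < p)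
    (fun p => ((absVal f k).factorization p : ℝ) * Real.log p)).symm
  rw [sum_filter_not_lt_eq f x k hn] at hsplit
  rw [log_eq_sum_primeFactors (absVal f k), hsplit]
  refine add_le_add ?_ le_rfl
  split_ifs with hbig
  · calc ∑ p ∈ (absVal f k).primeFactors.filter (fun p : ℕ => x < p),
          ((absVal f k).factorization p : ℝ) * Real.log p
        ≤ ∑ p ∈ (absVal f k).primeFactors, ((absVal f k).factorization p : ℝ) * Real.log p := by
          apply Finset.sum_le_sum_of_subset_of_nonneg (Finset.filter_subset _ _)
          intro p hp _
          have hp1 : (1 : ℝ) ≤ p := by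
            exact_mod_cast (Nat.prime_of_mem_primeFactors hp).one_lt.le
          exact mul_nonneg (by positivity) (Real.log_nonneg hp1)
      _ = Real.log (absVal f k) := (log_eq_sum_primeFactors _).symm
      _ ≤ Real.log ((height f * x ^ f.natDegree : ℕ) : ℝ) := by
          apply Real.log_le_log (by exact_mod_cast Nat.pos_of_ne_zero hn)
          exact_mod_cast absVal_le f hk1 hkx
  · have he : (absVal f k).primeFactors.filter (fun p : ℕ => x < p) = ∅ := by
      rw [Finset.filter_eq_empty_iff]
      intro p hp hxp
      exact hbig ⟨p, hp, hxp⟩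
    rw [he, Finset.sum_empty]

/-- Summed over `k`: `∑_{k ≤ x} log |f(k)| ≤ E log (H x^d) + ∑_{p ≤ x} log p ∑_{k ≤ x} v_p(|f(k)|)`. -/
theorem sum_log_absVal_le {f : ℤ[X]} (hirr : Irreducible f) (hdeg : 2 ≤ f.natDegree) (x : ℕ) :
    ∑ k ∈ Icc 1 x, Real.log (absVal f k) ≤
      (bigCount f x : ℝ) * Real.log ((height f * x ^ f.natDegree : ℕ) : ℝ)
      + ∑ p ∈ Nat.primesLE x, Real.log p * ∑ k ∈ Icc 1 x, ((absVal f k).factorization p : ℝ) := by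
  calc ∑ k ∈ Icc 1 x, Real.log (absVal f k)
      ≤ ∑ k ∈ Icc 1 x, ((if ∃ p ∈ (absVal f k).primeFactors, x < p
            then Real.log ((height f * x ^ f.natDegree : ℕ) : ℝ) else 0)
          + ∑ p ∈ Nat.primesLE x, ((absVal f k).factorization p : ℝ) * Real.log p) :=
        Finset.sum_le_sum fun k hk =>
          log_absVal_le hirr hdeg (Finset.mem_Icc.mp hk).1 (Finset.mem_Icc.mp hk).2
    _ = (bigCount f x : ℝ) * Real.log ((height f * x ^ f.natDegree : ℕ) : ℝ)
          + ∑ p ∈ Nat.primesLE x, Real.log p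
              * ∑ k ∈ Icc 1 x, ((absVal f k).factorization p : ℝ) := by
        rw [Finset.sum_add_distrib, Finset.sum_ite, Finset.sum_const_zero, add_zero, Finset.sum_const,
          nsmul_eq_mul, Finset.sum_comm]
        unfold bigCount
        congr 1
        apply Finset.sum_congr rfl
        intro p _
        rw [Finset.mul_sum]
        apply Finset.sum_congr rfl
        intro k _
        ring

/-! ### The theorem -/
/-- **Chebyshev–Markov–Nagell for an arbitrary irreducible polynomial** (explicit form): for `f`
irreducible of degree `d ≥ 2` there is `C` with
`(d − 1) x log x − C x ≤ E_f(x) · (d log x + C)` for all `x ≥ 2`, where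
`E_f(x) = #{1 ≤ k ≤ x : |f(k)| has a prime factor > x}`. -/
theorem bigCount_mul_log_ge {f : ℤ[X]} (hirr : Irreducible f) (hdeg : 2 ≤ f.natDegree) :
    ∃ C : ℝ, ∀ x : ℕ, 2 ≤ x →
      ((f.natDegree : ℝ) - 1) * x * Real.log x - C * x
        ≤ (bigCount f x : ℝ) * (f.natDegree * Real.log x + C) := by
  obtain ⟨M, -, hM⟩ := exists_polyRootCountMod_prime_pow_le hirr (by omega)
  obtain ⟨Cρ, hCρ⟩ :=
    Literature.NumberTheory.LFunctions.DegreeOnePrimes.abs_sum_primesLE_rootCount_mul_log_div_sub_log_le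
      f hirr (by omega)
  obtain ⟨L, hL⟩ := sum_log_absVal_ge hirr hdeg
  set d : ℕ := f.natDegree with hd
  set B : ℕ := d * M with hBdef
  have hB : ∀ p : ℕ, p.Prime → ∀ a : ℕ, polyRootCountMod ![f] (p ^ a) ≤ B := hM
  have hH1 : 1 ≤ height f := one_le_height hirr.ne_zero
  have hlogH : 0 ≤ Real.log (height f) := Real.log_nonneg (by exact_mod_cast hH1)
  set C : ℝ := Real.log (height f) + d + |L| + |Cρ| + B * Real.log 4 + 2 * B
      + 2 * B * Real.log (height f) + B * d * (2 * Real.log 4 + 2) with hC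
  refine ⟨C, fun x hx => ?_⟩
  have hx1 : 1 ≤ x := by omega
  have hx0 : (0 : ℝ) < x := by exact_mod_cast (by omega : 0 < x)
  have hxR1 : (1 : ℝ) ≤ x := by exact_mod_cast hx1
  have hlogx : 0 ≤ Real.log x := Real.log_nonneg hxR1
  have hB0 : (0 : ℝ) ≤ B := by positivity
  have hd0 : (0 : ℝ) ≤ d := by positivity
  have hl4 : 0 ≤ Real.log 4 := Real.log_nonneg (by norm_num)
  -- the pieces
  have hlow := hL x hx1
  have hup := sum_log_absVal_le hirr hdeg x
  have hsm := smooth_part_le hirr hdeg hB x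
  have hR : ∑ p ∈ Nat.primesLE x, (polyRootCountMod ![f] p : ℝ) * Real.log p / p
      ≤ Real.log x + Cρ := by
    have := (abs_le.mp (hCρ x hx)).2
    linarith
  have hθ : Chebyshev.theta (x : ℝ) ≤ Real.log 4 * x := Chebyshev.theta_le_log4_mul_x hx0.le
  have hP1 := card_primesLE_mul_log_le' hx
  have hP2 : ((Nat.primesLE x).card : ℝ) ≤ 2 * x := by
    have h := card_primesLE_le x
    have h' : ((Nat.primesLE x).card : ℝ) ≤ x + 1 := by exact_mod_cast h
    linarith
  have hN : Real.log ((height f * x ^ d : ℕ) : ℝ) = Real.log (height f) + d * Real.log x := by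
    push_cast
    rw [Real.log_mul (by positivity) (by positivity), Real.log_pow]
  rw [hN] at hup hsm
  -- products
  set E : ℝ := (bigCount f x : ℝ) with hE
  set P : ℝ := ((Nat.primesLE x).card : ℝ) with hP
  have hE0 : 0 ≤ E := by positivity
  have hP0 : 0 ≤ P := by positivity
  have hxR : (x : ℝ) * (∑ p ∈ Nat.primesLE x, (polyRootCountMod ![f] p : ℝ) * Real.log p / p)
      ≤ x * (Real.log x + Cρ) := mul_le_mul_of_nonneg_left hR hx0.le
  have hBθ : (B : ℝ) * Chebyshev.theta (x : ℝ) ≤ B * (Real.log 4 * x) :=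
    mul_le_mul_of_nonneg_left hθ hB0
  have hPlogH : P * Real.log (height f) ≤ 2 * x * Real.log (height f) :=
    mul_le_mul_of_nonneg_right hP2 hlogH
  have hBP : (B : ℝ) * P * (Real.log (height f) + d * Real.log x)
      ≤ B * (2 * x * Real.log (height f)) + B * d * ((2 * Real.log 4 + 2) * x) := by
    have e : (B : ℝ) * P * (Real.log (height f) + d * Real.log x)
        = B * (P * Real.log (height f)) + B * d * (P * Real.log x) := by ring
    rw [e]
    have h1 := mul_le_mul_of_nonneg_left hPlogH hB0
    have h2 := mul_le_mul_of_nonneg_left hP1 (mul_nonneg hB0 hd0)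
    linarith
  have hC1 : Real.log (height f) ≤ C := by
    rw [hC]
    have : 0 ≤ |L| := abs_nonneg _
    have : 0 ≤ |Cρ| := abs_nonneg _
    have := mul_nonneg hB0 hl4
    have := mul_nonneg hB0 hlogH
    have := mul_nonneg (mul_nonneg hB0 hd0) (by positivity : (0 : ℝ) ≤ 2 * Real.log 4 + 2)
    linarith
  have hC2 : (d : ℝ) + L + Cρ + B * Real.log 4 + 2 * B + 2 * B * Real.log (height f)
      + B * d * (2 * Real.log 4 + 2) ≤ C := by
    rw [hC]
    have : L ≤ |L| := le_abs_self _
    have : Cρ ≤ |Cρ| := le_abs_self _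
    linarith
  have hEC : E * Real.log (height f) ≤ E * C := mul_le_mul_of_nonneg_left hC1 hE0
  have hC2x := mul_le_mul_of_nonneg_right hC2 hx0.le
  -- assemble
  have key : (d : ℝ) * ((x : ℝ) * Real.log x - x) - L * x
      ≤ E * (Real.log (height f) + d * Real.log x) + x * (Real.log x + Cρ) + B * (Real.log 4 * x)
        + 2 * B * x + (B * (2 * x * Real.log (height f)) + B * d * ((2 * Real.log 4 + 2) * x)) := by
    linarith
  have e1 : ((d : ℝ) - 1) * x * Real.log x - C * x
      = (d * ((x : ℝ) * Real.log x - x) - L * x) - x * Real.log x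
        - (C - d - L) * x := by ring
  rw [e1]
  have e2 : E * ((d : ℝ) * Real.log x + C) = E * (Real.log (height f) + d * Real.log x)
      + (E * C - E * Real.log (height f)) := by ring
  rw [e2]
  linarith [key, hEC, hC2x]

/-- **Chebyshev–Markov–Nagell** (proportion form): for `f` irreducible of degree `d ≥ 2` and every
`ε > 0`, eventually `(1 − 1/d − ε) x ≤ #{1 ≤ k ≤ x : |f(k)| has a prime factor > x}`. -/
theorem eventually_bigCount_ge {f : ℤ[X]} (hirr : Irreducible f) (hdeg : 2 ≤ f.natDegree)
    {ε : ℝ} (hε : 0 < ε) :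
    ∀ᶠ x : ℕ in Filter.atTop,
      (1 - 1 / (f.natDegree : ℝ) - ε) * (x : ℝ) ≤ (bigCount f x : ℝ) := by
  obtain ⟨C, hC⟩ := bigCount_mul_log_ge hirr hdeg
  set d : ℕ := f.natDegree with hd
  have hdpos : (0 : ℝ) < d := by exact_mod_cast (by omega : 0 < d)
  set T : ℝ := (2 * |C| + 1) / (ε * d) + |C| with hT
  rw [Filter.eventually_atTop]
  refine ⟨max 2 (⌈Real.exp T⌉₊ + 1), fun x hx => ?_⟩
  have hx2 : 2 ≤ x := le_trans (le_max_left _ _) hx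
  have hxe : Real.exp T < x := by
    have h1 : (⌈Real.exp T⌉₊ : ℝ) + 1 ≤ x := by
      exact_mod_cast le_trans (le_max_right _ _) hx
    have h2 := Nat.le_ceil (Real.exp T)
    linarith
  have hx0 : (0 : ℝ) < x := by exact_mod_cast (by omega : 0 < x)
  have hlogx : T < Real.log x := by
    rw [Real.lt_log_iff_exp_lt hx0]
    exact hxe
  have habsC : 0 ≤ |C| := abs_nonneg C
  have hεd : 0 < ε * d := mul_pos hε hdpos
  have hT1 : (2 * |C| + 1) / (ε * d) ≤ T := by rw [hT]; linarith
  have hlog1 : 2 * |C| + 1 < ε * d * Real.log x := by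
    have := (div_lt_iff₀ hεd).mp (lt_of_le_of_lt hT1 hlogx)
    linarith
  have hlog2 : |C| < Real.log x := by
    have : 0 ≤ (2 * |C| + 1) / (ε * d) := div_nonneg (by positivity) hεd.le
    linarith
  have hmain := hC x hx2
  have hE0 : (0 : ℝ) ≤ bigCount f x := by positivity
  set a : ℝ := 1 - 1 / (d : ℝ) - ε with ha
  by_cases ha0 : a ≤ 0
  · have : a * (x : ℝ) ≤ 0 := mul_nonpos_of_nonpos_of_nonneg ha0 hx0.le
    linarith
  have ha0 : 0 < a := not_le.mp ha0
  have ha1 : a ≤ 1 := by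
    rw [ha]
    have : 0 ≤ 1 / (d : ℝ) := by positivity
    linarith
  have had : a * d = d - 1 - ε * d := by
    rw [ha, sub_mul, sub_mul, one_mul, one_div, inv_mul_cancel₀ hdpos.ne']
  -- `D = d log x + C > 0`
  have hCle : -|C| ≤ C := neg_abs_le C
  have hD : 0 < (d : ℝ) * Real.log x + C := by
    have hd1 : (1 : ℝ) ≤ d := by exact_mod_cast (by omega : 1 ≤ d)
    have hlx0 : 0 ≤ Real.log x := by linarith
    have : Real.log x ≤ d * Real.log x := le_mul_of_one_le_left hlx0 hd1
    linarith
  by_contra hcon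
  have hcon := not_le.mp hcon
  have h1 : (bigCount f x : ℝ) * ((d : ℝ) * Real.log x + C)
      < a * x * ((d : ℝ) * Real.log x + C) := mul_lt_mul_of_pos_right hcon hD
  have e1 : a * (x : ℝ) * ((d : ℝ) * Real.log x + C)
      = (a * d) * ((x : ℝ) * Real.log x) + a * C * x := by ring
  rw [e1, had] at h1
  have h3 : a * C * (x : ℝ) ≤ |C| * x := by
    apply mul_le_mul_of_nonneg_right _ hx0.le
    calc a * C ≤ a * |C| := mul_le_mul_of_nonneg_left (le_abs_self C) ha0.le
      _ ≤ |C| := mul_le_of_le_one_left habsC ha1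
  have h4 : C * (x : ℝ) ≤ |C| * x := mul_le_mul_of_nonneg_right (le_abs_self C) hx0.le
  have h5 : ε * d * ((x : ℝ) * Real.log x) < 2 * |C| * x := by linarith [hmain, h1, h3, h4]
  have h6 : (2 * |C| + 1) * (x : ℝ) < ε * d * Real.log x * x := mul_lt_mul_of_pos_right hlog1 hx0
  linarith [h5, h6, hx0]

end Summit.Parity.BatemanHorn.Theorems.SoloBlindNagell
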